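import Summits.CriticalPhenomena.CardyFormulaZ2.Theses.CardyBoundaryCoulombGas
import Literature.Probability.LatticeModels.CollarLegModel
import Literature.Probability.LatticeModels.DirichletGreenFunction

/-!
# Line `rainbow-monomials-in-excursion-kernels` — skeleton for crux `BoundaryDefectGaussianR`
# (stmt-CriticalPhenomena-14132, route `CardyBoundaryCoulombGas`, sub-problem `CardyFormulaZ2`)

crux-plan seat `planner-cruxplan-stmt-CriticalPhenomena-14132-rainbow-monomials-in-0`, 2026-08-16.
Idea card `Cruxes/BoundaryDefectGaussianR/Ideas/rainbow-monomials-in-excursion-kernels.md` (ideator 1;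
triage r1-1/r1-2/r1-3: pass). Line card: `Lines/rainbow-monomials-in-excursion-kernels.md`.

## The line in one paragraph

Write `P_V(p) := ‖Zins V ι(p)‖ / ‖Z V‖` for the rainbow probability of the leg family `(L, sink j)`
inserted at the boundary lattice points `p : Fin k → ℤ²` of a lattice domain `V`, `e_i := L_i`
(sources), `e_j := 1 - L_j` (sink), and let `G_V` be the Dirichlet Green function of simple random
walk killed on leaving `V` (tree: `dirichletGreen`). The GREEN MONOMIAL of the configuration is
`Λ_V(p) := Σ_{i<i'} (−e_i e_i'/6) · log G_V(p_i, p_i')` and the line's one functional is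
`F_V(p) := log P_V(p) − Λ_V(p)`. The idea card's law (GM) says `F → log C′` (one constant per family,
every rectilinear polygon, every admissible position, NO power of the mesh and NO uniformizing map);
`Σ e = 1` is exactly the condition under which the pair monomial reproduces the crux's one-body
weights `|w′|^{h(e_i)}` (`kac_from_pairs`, proved below), so (GM) plus the classical flat-edge
asymptotics of `G_V` IS the crux (`stub_transfer`). (GM) itself is split map-free into
RIGIDITY (`F` is asymptotically independent of the domain and of the positions: the covariance
content) and a REFERENCE LIMIT (`F` converges for one configuration per family: the sharpness
content), and rigidity is reduced to two LOCAL lattice laws — POINT TRANSPORT (sliding one insertion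
point one lattice step along its edge changes `F` by `o(δ)`, uniformly: the Hadamard/Ward "amplitude"
law of the card, for `(2;2)` the amplitude `1/3 = h_{1,3}` against the Green kernel; moving it by a
macroscopically small distance `ρ`, in particular ACROSS A CORNER, changes `F` by `o_ρ(1)`) and
CLUSTER LOCALITY (a configuration clustered at scale `ρ` at a flat boundary point does not feel the
rest of the domain: `o_ρ(1)` in `F`) — by transporting all points along `∂Ω` into a cluster on the
lowest edge, jumping to the reference domain, and un-clustering there (`stub_rigidity_of_local_laws`).

## Stubs (registered; every statement written out over tree constants, no local definitions)

* `stub_pointTransport`      — (a) unit slide: `|ΔF| ≤ ε·δ` eventually, uniformly on `r`-flat,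
                                `r`-separated admissible configurations of a fixed rectilinear Jordan
                                domain; (b) `ρ`-jump of one point (corner crossing): `|ΔF| ≤ ε`.  [LEVER; XL]
* `stub_clusterLocality`     — clusters of diameter `ρ` at bottom-type flat points of two domains,
                                translated onto each other: `|F − F′| ≤ ε` eventually.  [L]
* `stub_rigidity_of_local_laws` — PointTransport → ClusterLocality → Rigidity.  [M–L: realisability
                                (eventual positivity), admissible transport paths, telescoping, compactness]
* `stub_referenceLimit`      — some reference configuration per family is approximable by admissible
                                lattice data along every mesh sequence and `F` converges there.  [L–XL: sharp asymptotics]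
* `stub_greenKernelAsymptotics` — `G_{V_n}(x_n,y_n)/δ_n² → c·|w′(x)||w′(y)|/|w(x)−w(y)|²` at flat
                                boundary points of rectilinear polygons (`c` universal).  [L: classical discrete potential theory]
* `stub_transfer`            — Rigidity → ReferenceLimit → GreenKernelAsymptotics → crux (limit
                                algebra: the `δ`-powers cancel by `2Σ_{i<i'}(−e_ie_i'/6) = Σh(e_i)`,
                                the `|w′|` exponents by `kac_from_pairs`; plus the orientation lemma
                                "monotone boundary values of `w` ⇒ interior on the left").  [M–L]
* `BoundaryDefectGaussianR_of` — the composition, concluding the crux BY NAME (no sorry outside stubs).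

Disproof.lean (cycle 2 v4) honoured: `∃ C ∀ Ω ∀ ins ∀ w` typing (§5 H-onto) is the crux's; the stubs
never quantify a law "in all frames" (§2 `not_lawInAllMoebiusFrames_naiveSink` is the converse of
`kac_from_pairs`: a label vector with `Σe ≠ 1` leaves a one-body residual); no uniformity up to the
diagonal is claimed anywhere (§4 `not_halfPlaneTwoPointLawUniform`: all configuration sets below are
`r`-separated); corners are excluded from insertion positions (§5 H-noncorner, §7(C)) — they are
crossed at scale `ρ`, never occupied; the `(1;1)` unit test (§5 H-k) reads `e = (1,0)`, `Λ ≡ 0`.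
No landed `Negative/` lemma refutes an instance of a stub (the landed `MarkDensityPartition` lemmas
are identities used BY the disprover's cap `C ≤ cardyConst/3`, consistent with `stub_referenceLimit`).
-/

noncomputable section

open Filter Topology

namespace Summit.CriticalPhenomena.CardyFormulaZ2.Cruxes.BoundaryDefectGaussianR.RainbowMonomialsInExcursionKernels

/-! ### The exponent bookkeeping of the line (proved) -/

/-- **`Σe = 1` ⟺ no one-body factor.** For a label vector with `Σ_j e_j = 1`, the total exponent the
pair monomial `∏_{j ≠ i} K(x_i,x_j)^{-e_i e_j/6}` assigns to the point `x_i` is the Kac weight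
`h(e_i) = e_i (e_i - 1)/6` — the identity that turns `∏ K_Ω^{-e_ie_j/6}` into the crux's
`∏ |w_i - w_j|^{e_ie_j/3} ∏ |w′_i|^{h(e_i)}` (idea card, `Sketch.kac_from_pairs`). [folklore] -/
theorem kac_from_pairs {k : ℕ} (e : Fin k → ℝ) (hsum : ∑ j, e j = 1) (i : Fin k) :
    ∑ j ∈ Finset.univ.erase i, (-(e i * e j) / 6) = e i * (e i - 1) / 6 := by
  have h1 : ∑ j ∈ Finset.univ.erase i, (-(e i * e j) / 6) = -(e i / 6) * ∑ j ∈ Finset.univ.erase i, e j := by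
    rw [Finset.mul_sum]
    refine Finset.sum_congr rfl fun j _ => ?_
    ring
  rw [h1, Finset.sum_erase_eq_sub (Finset.mem_univ i), hsum]
  ring

/-- The mesh powers cancel: `2 Σ_{i<i'} (-e_i e_i'/6) = Σ_i h(e_i)` when `Σ e = 1` (both equal
`(Σ e² - 1)/6`); this is why the Green-monomial law carries no power of `δ`. Stated over the
ordered-pair sum `Σ_i Σ_{i' ≠ i}` (= twice the sum over `i < i'`). [folklore] -/
theorem mesh_powers_cancel {k : ℕ} (e : Fin k → ℝ) (hsum : ∑ j, e j = 1) :
    ∑ i, ∑ i' ∈ Finset.univ.erase i, (-(e i * e i') / 6) = ∑ i, e i * (e i - 1) / 6 :=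
  Finset.sum_congr rfl fun i _ => kac_from_pairs e hsum i

/-! ### Stub 1 — POINT TRANSPORT (the lever: Hadamard/Ward response of `F` to moving one insertion point) -/

/-- **Stub 1 (lever) — point transport.** For a leg family `(L, sink j)` and a rectilinear
Jordan domain `D` discretised at mesh `δ_n → 0⁺` (`V_n = {v : δ_n v ∈ closure D}`):
(a) UNIT SLIDE — eventually in `n`, uniformly over admissible injective configurations `p` whose points
are `r/δ_n`-flat (the lattice ball of that radius around each point meets `V_n` in a discrete
half-plane) and pairwise `r/δ_n`-separated, sliding ONE point by one lattice step along its edge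
(`p′ = update p i (p i + τ)`, still admissible, both rainbow probabilities positive) changes
`F = log P − Λ` by at most `ε·δ_n`: the discrete logarithmic derivative of the rainbow probability in
each insertion point IS that of the Green monomial, to first order ("amplitude law"; for `(2;2)`:
`P[x+1↔y]/P[x↔y] = (G(x+1,y)/G(x,y))^{1/3} + o(δ)`); (b) `ρ`-JUMP — for some `ρ = ρ(r, ε) ≤ r`,
replacing one point by another admissible `ρ/4·δ_n⁻¹`-flat point within lattice distance `ρ/δ_n`
(the other points `r`-flat, everything `r`-separated) changes `F` by at most `ε`; used only to cross
convex and reflex corners at scale `ρ`. Why plausibly true: (GM) in differential form; (a) is a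
first-order local CLT for a translation of one insertion (coupling `x ↔ x+τ` by the local reflection,
broken only by the global geometry at order `δ`), (b) is macroscopic continuity of `F` across a
corner (Disproof §7(B): the corner-proximity law of the `(2;2)` amplitude is parameter-free and passes
at 0.3 %). Size: XL (open; it carries the conformal-covariance content in Hadamard form). [folklore] -/
theorem stub_pointTransport :
    ∀ (k : ℕ) (L : Fin k → ℕ) (j : Fin k), L j = ∑ i ∈ Finset.univ.erase j, L i → (∀ (D :
    Literature.Probability.RandomPlanarGeometry.JordanDomain), (∃ S : Finset (ℂ × ℂ), (∀ q ∈ S, q.1.re = q.2.re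
    ∨ q.1.im = q.2.im) ∧ frontier D.carrier ⊆ ⋃ q ∈ S, segment ℝ q.1 q.2) → ∀ (r ε : ℝ), 0 < r → 0 < ε → ∀ (δ :
    ℕ → ℝ), (∀ n, 0 < δ n) → Filter.Tendsto δ Filter.atTop (nhds 0) → ∀ (V : ℕ → Finset (ℤ × ℤ)), (∀ n, ∀ v : ℤ
    × ℤ, v ∈ V n ↔ (((v).1 : ℂ) * ((δ n : ℝ) : ℂ) + ((v).2 : ℂ) * ((δ n : ℝ) : ℂ) * Complex.I) ∈ closure
    D.carrier) → ∀ᶠ n in Filter.atTop, ∀ (p : Fin k → ℤ × ℤ) (i : Fin k) (τ : ℤ × ℤ), (τ = (1, 0) ∨ τ = (-1, 0)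
    ∨ τ = (0, 1) ∨ τ = (0, -1)) → Function.Injective p → Function.Injective (Function.update p i (p i + τ)) →
    Literature.Probability.LatticeModels.CollarLegModel.LegInsertionData.IsAdmissible (⟨(Finset.univ.erase
    j).image (p), fun v ↦ ∑ b ∈ (Finset.univ.erase j).filter (fun b ↦ (p) b = v), L b, (p) j⟩ :
    Literature.Probability.LatticeModels.CollarLegModel.LegInsertionData) (V n) →
    Literature.Probability.LatticeModels.CollarLegModel.LegInsertionData.IsAdmissible (⟨(Finset.univ.erase
    j).image ((Function.update p i (p i + τ))), fun v ↦ ∑ b ∈ (Finset.univ.erase j).filter (fun b ↦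
    ((Function.update p i (p i + τ))) b = v), L b, ((Function.update p i (p i + τ))) j⟩ :
    Literature.Probability.LatticeModels.CollarLegModel.LegInsertionData) (V n) → 0 <
    (‖Literature.Probability.LatticeModels.CollarLegModel.Zins (V n) (⟨(Finset.univ.erase j).image (p), fun v ↦
    ∑ b ∈ (Finset.univ.erase j).filter (fun b ↦ (p) b = v), L b, (p) j⟩ :
    Literature.Probability.LatticeModels.CollarLegModel.LegInsertionData)‖ /
    ‖(Literature.Probability.LatticeModels.CollarLegModel.ofDomain (V n)).Z‖) → 0 <
    (‖Literature.Probability.LatticeModels.CollarLegModel.Zins (V n) (⟨(Finset.univ.erase j).image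
    ((Function.update p i (p i + τ))), fun v ↦ ∑ b ∈ (Finset.univ.erase j).filter (fun b ↦ ((Function.update p i
    (p i + τ))) b = v), L b, ((Function.update p i (p i + τ))) j⟩ :
    Literature.Probability.LatticeModels.CollarLegModel.LegInsertionData)‖ /
    ‖(Literature.Probability.LatticeModels.CollarLegModel.ofDomain (V n)).Z‖) → (∀ i', (∃ d : ℤ × ℤ, (d = (1, 0)
    ∨ d = (-1, 0) ∨ d = (0, 1) ∨ d = (0, -1)) ∧ ∀ v : ℤ × ℤ, (((((v).1 - (p i').1) ^ 2 + ((v).2 - (p i').2) ^ 2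
    : ℤ) : ℝ)) ≤ (r / δ n) ^ 2 → (v ∈ V n ↔ 0 ≤ (v.1 - (p i').1) * d.1 + (v.2 - (p i').2) * d.2))) → (∀ i₁ i₂ :
    Fin k, i₁ ≠ i₂ → (r / δ n) ^ 2 ≤ ((((((p) i₁).1 - ((p) i₂).1) ^ 2 + (((p) i₁).2 - ((p) i₂).2) ^ 2 : ℤ) :
    ℝ))) → |(Real.log (‖Literature.Probability.LatticeModels.CollarLegModel.Zins (V n) (⟨(Finset.univ.erase
    j).image ((Function.update p i (p i + τ))), fun v ↦ ∑ b ∈ (Finset.univ.erase j).filter (fun b ↦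
    ((Function.update p i (p i + τ))) b = v), L b, ((Function.update p i (p i + τ))) j⟩ :
    Literature.Probability.LatticeModels.CollarLegModel.LegInsertionData)‖ /
    ‖(Literature.Probability.LatticeModels.CollarLegModel.ofDomain (V n)).Z‖) - (∑ i₁ : Fin k, ∑ i₂ ∈
    Finset.univ.filter (fun i₂ : Fin k ↦ i₁ < i₂), (-((if i₁ = j then (1 - (L j : ℝ)) else (L i₁ : ℝ)) * (if i₂
    = j then (1 - (L j : ℝ)) else (L i₂ : ℝ))) / 6) * Real.log
    (Literature.Probability.LatticeModels.dirichletGreen ((V n).image (fun v : ℤ × ℤ ↦ (![v.1, v.2] : Fin 2 →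
    ℤ))) (![(((Function.update p i (p i + τ))) i₁).1, (((Function.update p i (p i + τ))) i₁).2] : Fin 2 → ℤ)
    (![(((Function.update p i (p i + τ))) i₂).1, (((Function.update p i (p i + τ))) i₂).2] : Fin 2 → ℤ)))) -
    (Real.log (‖Literature.Probability.LatticeModels.CollarLegModel.Zins (V n) (⟨(Finset.univ.erase j).image
    (p), fun v ↦ ∑ b ∈ (Finset.univ.erase j).filter (fun b ↦ (p) b = v), L b, (p) j⟩ :
    Literature.Probability.LatticeModels.CollarLegModel.LegInsertionData)‖ /
    ‖(Literature.Probability.LatticeModels.CollarLegModel.ofDomain (V n)).Z‖) - (∑ i₁ : Fin k, ∑ i₂ ∈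
    Finset.univ.filter (fun i₂ : Fin k ↦ i₁ < i₂), (-((if i₁ = j then (1 - (L j : ℝ)) else (L i₁ : ℝ)) * (if i₂
    = j then (1 - (L j : ℝ)) else (L i₂ : ℝ))) / 6) * Real.log
    (Literature.Probability.LatticeModels.dirichletGreen ((V n).image (fun v : ℤ × ℤ ↦ (![v.1, v.2] : Fin 2 →
    ℤ))) (![((p) i₁).1, ((p) i₁).2] : Fin 2 → ℤ) (![((p) i₂).1, ((p) i₂).2] : Fin 2 → ℤ))))| ≤ ε * δ n) ∧ (∀ (D
    : Literature.Probability.RandomPlanarGeometry.JordanDomain), (∃ S : Finset (ℂ × ℂ), (∀ q ∈ S, q.1.re =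
    q.2.re ∨ q.1.im = q.2.im) ∧ frontier D.carrier ⊆ ⋃ q ∈ S, segment ℝ q.1 q.2) → ∀ (r ε : ℝ), 0 < r → 0 < ε →
    ∃ ρ : ℝ, 0 < ρ ∧ ρ ≤ r ∧ ∀ (δ : ℕ → ℝ), (∀ n, 0 < δ n) → Filter.Tendsto δ Filter.atTop (nhds 0) → ∀ (V : ℕ →
    Finset (ℤ × ℤ)), (∀ n, ∀ v : ℤ × ℤ, v ∈ V n ↔ (((v).1 : ℂ) * ((δ n : ℝ) : ℂ) + ((v).2 : ℂ) * ((δ n : ℝ) : ℂ)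
    * Complex.I) ∈ closure D.carrier) → ∀ᶠ n in Filter.atTop, ∀ (p : Fin k → ℤ × ℤ) (i : Fin k) (q : ℤ × ℤ),
    Function.Injective p → Function.Injective (Function.update p i q) →
    Literature.Probability.LatticeModels.CollarLegModel.LegInsertionData.IsAdmissible (⟨(Finset.univ.erase
    j).image (p), fun v ↦ ∑ b ∈ (Finset.univ.erase j).filter (fun b ↦ (p) b = v), L b, (p) j⟩ :
    Literature.Probability.LatticeModels.CollarLegModel.LegInsertionData) (V n) →
    Literature.Probability.LatticeModels.CollarLegModel.LegInsertionData.IsAdmissible (⟨(Finset.univ.erase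
    j).image ((Function.update p i q)), fun v ↦ ∑ b ∈ (Finset.univ.erase j).filter (fun b ↦ ((Function.update p
    i q)) b = v), L b, ((Function.update p i q)) j⟩ :
    Literature.Probability.LatticeModels.CollarLegModel.LegInsertionData) (V n) → 0 <
    (‖Literature.Probability.LatticeModels.CollarLegModel.Zins (V n) (⟨(Finset.univ.erase j).image (p), fun v ↦
    ∑ b ∈ (Finset.univ.erase j).filter (fun b ↦ (p) b = v), L b, (p) j⟩ :
    Literature.Probability.LatticeModels.CollarLegModel.LegInsertionData)‖ /
    ‖(Literature.Probability.LatticeModels.CollarLegModel.ofDomain (V n)).Z‖) → 0 <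
    (‖Literature.Probability.LatticeModels.CollarLegModel.Zins (V n) (⟨(Finset.univ.erase j).image
    ((Function.update p i q)), fun v ↦ ∑ b ∈ (Finset.univ.erase j).filter (fun b ↦ ((Function.update p i q)) b =
    v), L b, ((Function.update p i q)) j⟩ :
    Literature.Probability.LatticeModels.CollarLegModel.LegInsertionData)‖ /
    ‖(Literature.Probability.LatticeModels.CollarLegModel.ofDomain (V n)).Z‖) → (∀ i', i' ≠ i → (∃ d : ℤ × ℤ, (d
    = (1, 0) ∨ d = (-1, 0) ∨ d = (0, 1) ∨ d = (0, -1)) ∧ ∀ v : ℤ × ℤ, (((((v).1 - (p i').1) ^ 2 + ((v).2 - (p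
    i').2) ^ 2 : ℤ) : ℝ)) ≤ (r / δ n) ^ 2 → (v ∈ V n ↔ 0 ≤ (v.1 - (p i').1) * d.1 + (v.2 - (p i').2) * d.2))) →
    (∃ d : ℤ × ℤ, (d = (1, 0) ∨ d = (-1, 0) ∨ d = (0, 1) ∨ d = (0, -1)) ∧ ∀ v : ℤ × ℤ, (((((v).1 - (p i).1) ^ 2
    + ((v).2 - (p i).2) ^ 2 : ℤ) : ℝ)) ≤ (ρ / 4 / δ n) ^ 2 → (v ∈ V n ↔ 0 ≤ (v.1 - (p i).1) * d.1 + (v.2 - (p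
    i).2) * d.2)) → (∃ d : ℤ × ℤ, (d = (1, 0) ∨ d = (-1, 0) ∨ d = (0, 1) ∨ d = (0, -1)) ∧ ∀ v : ℤ × ℤ, (((((v).1
    - (q).1) ^ 2 + ((v).2 - (q).2) ^ 2 : ℤ) : ℝ)) ≤ (ρ / 4 / δ n) ^ 2 → (v ∈ V n ↔ 0 ≤ (v.1 - (q).1) * d.1 +
    (v.2 - (q).2) * d.2)) → (∀ i₁ i₂ : Fin k, i₁ ≠ i₂ → (r / δ n) ^ 2 ≤ ((((((p) i₁).1 - ((p) i₂).1) ^ 2 + (((p)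
    i₁).2 - ((p) i₂).2) ^ 2 : ℤ) : ℝ))) → (∀ i₁ i₂ : Fin k, i₁ ≠ i₂ → (r / δ n) ^ 2 ≤ (((((((Function.update p i
    q)) i₁).1 - (((Function.update p i q)) i₂).1) ^ 2 + ((((Function.update p i q)) i₁).2 - (((Function.update p
    i q)) i₂).2) ^ 2 : ℤ) : ℝ))) → (((((q).1 - (p i).1) ^ 2 + ((q).2 - (p i).2) ^ 2 : ℤ) : ℝ)) ≤ (ρ / δ n) ^ 2 →
    |(Real.log (‖Literature.Probability.LatticeModels.CollarLegModel.Zins (V n) (⟨(Finset.univ.erase j).image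
    ((Function.update p i q)), fun v ↦ ∑ b ∈ (Finset.univ.erase j).filter (fun b ↦ ((Function.update p i q)) b =
    v), L b, ((Function.update p i q)) j⟩ :
    Literature.Probability.LatticeModels.CollarLegModel.LegInsertionData)‖ /
    ‖(Literature.Probability.LatticeModels.CollarLegModel.ofDomain (V n)).Z‖) - (∑ i₁ : Fin k, ∑ i₂ ∈
    Finset.univ.filter (fun i₂ : Fin k ↦ i₁ < i₂), (-((if i₁ = j then (1 - (L j : ℝ)) else (L i₁ : ℝ)) * (if i₂
    = j then (1 - (L j : ℝ)) else (L i₂ : ℝ))) / 6) * Real.log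
    (Literature.Probability.LatticeModels.dirichletGreen ((V n).image (fun v : ℤ × ℤ ↦ (![v.1, v.2] : Fin 2 →
    ℤ))) (![(((Function.update p i q)) i₁).1, (((Function.update p i q)) i₁).2] : Fin 2 → ℤ)
    (![(((Function.update p i q)) i₂).1, (((Function.update p i q)) i₂).2] : Fin 2 → ℤ)))) - (Real.log
    (‖Literature.Probability.LatticeModels.CollarLegModel.Zins (V n) (⟨(Finset.univ.erase j).image (p), fun v ↦
    ∑ b ∈ (Finset.univ.erase j).filter (fun b ↦ (p) b = v), L b, (p) j⟩ :
    Literature.Probability.LatticeModels.CollarLegModel.LegInsertionData)‖ /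
    ‖(Literature.Probability.LatticeModels.CollarLegModel.ofDomain (V n)).Z‖) - (∑ i₁ : Fin k, ∑ i₂ ∈
    Finset.univ.filter (fun i₂ : Fin k ↦ i₁ < i₂), (-((if i₁ = j then (1 - (L j : ℝ)) else (L i₁ : ℝ)) * (if i₂
    = j then (1 - (L j : ℝ)) else (L i₂ : ℝ))) / 6) * Real.log
    (Literature.Probability.LatticeModels.dirichletGreen ((V n).image (fun v : ℤ × ℤ ↦ (![v.1, v.2] : Fin 2 →
    ℤ))) (![((p) i₁).1, ((p) i₁).2] : Fin 2 → ℤ) (![((p) i₂).1, ((p) i₂).2] : Fin 2 → ℤ))))| ≤ ε) := by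
  sorry

/-! ### Stub 2 — CLUSTER LOCALITY -/

/-- **Stub 2 — cluster locality (scale-free lattice form).** For every `ε` there is a ratio `M` such that for ANY two
finite lattice domains `V, V′ ⊂ ℤ²`, anchors `a, a′` and cluster radius `m ≥ 1` whose environments are flat of bottom type up to
radius `M·m` (the lattice ball of radius `M·m` around the anchor meets the domain exactly in the discrete upper half-plane through the
anchor's row), every admissible injective configuration `p` within distance `m` of `a`, translated by `a′ − a` into `V′` (admissible
there, both rainbow probabilities positive), has `|F_V(p) − F_{V′}(p − a + a′)| ≤ ε`: a cluster of insertions in a flat environment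
feels the geometry beyond `M` cluster radii only through a relative error `o_M(1)` in `P` (arm separation; note rainbow events need not
be monotone in the domain) and in each `G(p_i,p_i′)` (monotone in the domain; dipole–dipole kernels between nearby boundary points,
relative error `O(M⁻²)`), UNIFORMLY in the cluster radius down to lattice scale. No continuum domain, mesh or orientation enters (the
lattice functional `F` knows no parametrisation; footprint chirality is `CollarLegModel`'s fixed ccw walk on both sides). Size: L. [folklore] -/
theorem stub_clusterLocality :
    ∀ (k : ℕ) (L : Fin k → ℕ) (j : Fin k), L j = ∑ i ∈ Finset.univ.erase j, L i → ∀ ε : ℝ, 0 < ε → ∃ M : ℝ, 0 <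
    M ∧ ∀ (V V' : Finset (ℤ × ℤ)) (a a' : ℤ × ℤ) (m : ℝ), 1 ≤ m → (∀ v : ℤ × ℤ, (((((v).1 - (a).1) ^ 2 + ((v).2
    - (a).2) ^ 2 : ℤ) : ℝ)) ≤ (M * m) ^ 2 → (v ∈ V ↔ 0 ≤ v.2 - (a).2)) → (∀ v : ℤ × ℤ, (((((v).1 - (a').1) ^ 2 +
    ((v).2 - (a').2) ^ 2 : ℤ) : ℝ)) ≤ (M * m) ^ 2 → (v ∈ V' ↔ 0 ≤ v.2 - (a').2)) → ∀ (p : Fin k → ℤ × ℤ),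
    Function.Injective p → (∀ i, (((((p i).1 - (a).1) ^ 2 + ((p i).2 - (a).2) ^ 2 : ℤ) : ℝ)) ≤ m ^ 2) →
    Literature.Probability.LatticeModels.CollarLegModel.LegInsertionData.IsAdmissible (⟨(Finset.univ.erase
    j).image (p), fun v ↦ ∑ b ∈ (Finset.univ.erase j).filter (fun b ↦ (p) b = v), L b, (p) j⟩ :
    Literature.Probability.LatticeModels.CollarLegModel.LegInsertionData) (V) →
    Literature.Probability.LatticeModels.CollarLegModel.LegInsertionData.IsAdmissible (⟨(Finset.univ.erase
    j).image ((fun i ↦ p i - a + a')), fun v ↦ ∑ b ∈ (Finset.univ.erase j).filter (fun b ↦ ((fun i ↦ p i - a +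
    a')) b = v), L b, ((fun i ↦ p i - a + a')) j⟩ :
    Literature.Probability.LatticeModels.CollarLegModel.LegInsertionData) (V') → 0 <
    (‖Literature.Probability.LatticeModels.CollarLegModel.Zins (V) (⟨(Finset.univ.erase j).image (p), fun v ↦ ∑
    b ∈ (Finset.univ.erase j).filter (fun b ↦ (p) b = v), L b, (p) j⟩ :
    Literature.Probability.LatticeModels.CollarLegModel.LegInsertionData)‖ /
    ‖(Literature.Probability.LatticeModels.CollarLegModel.ofDomain (V)).Z‖) → 0 <
    (‖Literature.Probability.LatticeModels.CollarLegModel.Zins (V') (⟨(Finset.univ.erase j).image ((fun i ↦ p i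
    - a + a')), fun v ↦ ∑ b ∈ (Finset.univ.erase j).filter (fun b ↦ ((fun i ↦ p i - a + a')) b = v), L b, ((fun
    i ↦ p i - a + a')) j⟩ : Literature.Probability.LatticeModels.CollarLegModel.LegInsertionData)‖ /
    ‖(Literature.Probability.LatticeModels.CollarLegModel.ofDomain (V')).Z‖) → |(Real.log
    (‖Literature.Probability.LatticeModels.CollarLegModel.Zins (V) (⟨(Finset.univ.erase j).image (p), fun v ↦ ∑
    b ∈ (Finset.univ.erase j).filter (fun b ↦ (p) b = v), L b, (p) j⟩ :
    Literature.Probability.LatticeModels.CollarLegModel.LegInsertionData)‖ /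
    ‖(Literature.Probability.LatticeModels.CollarLegModel.ofDomain (V)).Z‖) - (∑ i₁ : Fin k, ∑ i₂ ∈
    Finset.univ.filter (fun i₂ : Fin k ↦ i₁ < i₂), (-((if i₁ = j then (1 - (L j : ℝ)) else (L i₁ : ℝ)) * (if i₂
    = j then (1 - (L j : ℝ)) else (L i₂ : ℝ))) / 6) * Real.log
    (Literature.Probability.LatticeModels.dirichletGreen ((V).image (fun v : ℤ × ℤ ↦ (![v.1, v.2] : Fin 2 → ℤ)))
    (![((p) i₁).1, ((p) i₁).2] : Fin 2 → ℤ) (![((p) i₂).1, ((p) i₂).2] : Fin 2 → ℤ)))) - (Real.log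
    (‖Literature.Probability.LatticeModels.CollarLegModel.Zins (V') (⟨(Finset.univ.erase j).image ((fun i ↦ p i
    - a + a')), fun v ↦ ∑ b ∈ (Finset.univ.erase j).filter (fun b ↦ ((fun i ↦ p i - a + a')) b = v), L b, ((fun
    i ↦ p i - a + a')) j⟩ : Literature.Probability.LatticeModels.CollarLegModel.LegInsertionData)‖ /
    ‖(Literature.Probability.LatticeModels.CollarLegModel.ofDomain (V')).Z‖) - (∑ i₁ : Fin k, ∑ i₂ ∈
    Finset.univ.filter (fun i₂ : Fin k ↦ i₁ < i₂), (-((if i₁ = j then (1 - (L j : ℝ)) else (L i₁ : ℝ)) * (if i₂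
    = j then (1 - (L j : ℝ)) else (L i₂ : ℝ))) / 6) * Real.log
    (Literature.Probability.LatticeModels.dirichletGreen ((V').image (fun v : ℤ × ℤ ↦ (![v.1, v.2] : Fin 2 →
    ℤ))) (![(((fun i ↦ p i - a + a')) i₁).1, (((fun i ↦ p i - a + a')) i₁).2] : Fin 2 → ℤ) (![(((fun i ↦ p i - a
    + a')) i₂).1, (((fun i ↦ p i - a + a')) i₂).2] : Fin 2 → ℤ))))| ≤ ε := by
  sorry

/-! ### Stub 3 — RIGIDITY from the two local laws (map-free covariance content of the crux) -/

/-- **Stub 3 — rigidity from the local laws.** PointTransport → ClusterLocality → RIGIDITY, where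
RIGIDITY says: for two rectilinear marked domains `D, D′ : MarkedDomain k` with non-corner marks, both
positively oriented at the sink mark (interior on the left), discretised along the SAME mesh sequence,
and admissible injective lattice configurations `p_n → D.pt`, `p′_n → D′.pt`: the rainbow
probabilities are eventually positive (realisability) and `F_{V_n}(p_n) − F_{V′_n}(p′_n) → 0`. Proof
plan (this stub's content): realisability of rainbow data at fine mesh; existence of ADMISSIBLE
transport paths (slide every point along `∂D`, crossing the finitely many corners at scale `ρ`, into a
cluster of diameter `ρ` at an interior point of the lowest edge of `D` — every rectilinear Jordan
polygon has a bottom-type edge; jump to `D′` by cluster locality; un-cluster in `D′`), `O(1/δ)` slides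
at `o(δ)` each + `O(1)` jumps at `o_ρ(1)` each + one locality jump, telescoped; compactness of the
`r`-separated configuration sets makes the three stubs' uniformity sufficient. Size: M–L. [folklore] -/
theorem stub_rigidity_of_local_laws :
    (∀ (k : ℕ) (L : Fin k → ℕ) (j : Fin k), L j = ∑ i ∈ Finset.univ.erase j, L i → (∀ (D :
    Literature.Probability.RandomPlanarGeometry.JordanDomain), (∃ S : Finset (ℂ × ℂ), (∀ q ∈ S, q.1.re = q.2.re
    ∨ q.1.im = q.2.im) ∧ frontier D.carrier ⊆ ⋃ q ∈ S, segment ℝ q.1 q.2) → ∀ (r ε : ℝ), 0 < r → 0 < ε → ∀ (δ :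
    ℕ → ℝ), (∀ n, 0 < δ n) → Filter.Tendsto δ Filter.atTop (nhds 0) → ∀ (V : ℕ → Finset (ℤ × ℤ)), (∀ n, ∀ v : ℤ
    × ℤ, v ∈ V n ↔ (((v).1 : ℂ) * ((δ n : ℝ) : ℂ) + ((v).2 : ℂ) * ((δ n : ℝ) : ℂ) * Complex.I) ∈ closure
    D.carrier) → ∀ᶠ n in Filter.atTop, ∀ (p : Fin k → ℤ × ℤ) (i : Fin k) (τ : ℤ × ℤ), (τ = (1, 0) ∨ τ = (-1, 0)
    ∨ τ = (0, 1) ∨ τ = (0, -1)) → Function.Injective p → Function.Injective (Function.update p i (p i + τ)) →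
    Literature.Probability.LatticeModels.CollarLegModel.LegInsertionData.IsAdmissible (⟨(Finset.univ.erase
    j).image (p), fun v ↦ ∑ b ∈ (Finset.univ.erase j).filter (fun b ↦ (p) b = v), L b, (p) j⟩ :
    Literature.Probability.LatticeModels.CollarLegModel.LegInsertionData) (V n) →
    Literature.Probability.LatticeModels.CollarLegModel.LegInsertionData.IsAdmissible (⟨(Finset.univ.erase
    j).image ((Function.update p i (p i + τ))), fun v ↦ ∑ b ∈ (Finset.univ.erase j).filter (fun b ↦
    ((Function.update p i (p i + τ))) b = v), L b, ((Function.update p i (p i + τ))) j⟩ :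
    Literature.Probability.LatticeModels.CollarLegModel.LegInsertionData) (V n) → 0 <
    (‖Literature.Probability.LatticeModels.CollarLegModel.Zins (V n) (⟨(Finset.univ.erase j).image (p), fun v ↦
    ∑ b ∈ (Finset.univ.erase j).filter (fun b ↦ (p) b = v), L b, (p) j⟩ :
    Literature.Probability.LatticeModels.CollarLegModel.LegInsertionData)‖ /
    ‖(Literature.Probability.LatticeModels.CollarLegModel.ofDomain (V n)).Z‖) → 0 <
    (‖Literature.Probability.LatticeModels.CollarLegModel.Zins (V n) (⟨(Finset.univ.erase j).image
    ((Function.update p i (p i + τ))), fun v ↦ ∑ b ∈ (Finset.univ.erase j).filter (fun b ↦ ((Function.update p i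
    (p i + τ))) b = v), L b, ((Function.update p i (p i + τ))) j⟩ :
    Literature.Probability.LatticeModels.CollarLegModel.LegInsertionData)‖ /
    ‖(Literature.Probability.LatticeModels.CollarLegModel.ofDomain (V n)).Z‖) → (∀ i', (∃ d : ℤ × ℤ, (d = (1, 0)
    ∨ d = (-1, 0) ∨ d = (0, 1) ∨ d = (0, -1)) ∧ ∀ v : ℤ × ℤ, (((((v).1 - (p i').1) ^ 2 + ((v).2 - (p i').2) ^ 2
    : ℤ) : ℝ)) ≤ (r / δ n) ^ 2 → (v ∈ V n ↔ 0 ≤ (v.1 - (p i').1) * d.1 + (v.2 - (p i').2) * d.2))) → (∀ i₁ i₂ :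
    Fin k, i₁ ≠ i₂ → (r / δ n) ^ 2 ≤ ((((((p) i₁).1 - ((p) i₂).1) ^ 2 + (((p) i₁).2 - ((p) i₂).2) ^ 2 : ℤ) :
    ℝ))) → |(Real.log (‖Literature.Probability.LatticeModels.CollarLegModel.Zins (V n) (⟨(Finset.univ.erase
    j).image ((Function.update p i (p i + τ))), fun v ↦ ∑ b ∈ (Finset.univ.erase j).filter (fun b ↦
    ((Function.update p i (p i + τ))) b = v), L b, ((Function.update p i (p i + τ))) j⟩ :
    Literature.Probability.LatticeModels.CollarLegModel.LegInsertionData)‖ /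
    ‖(Literature.Probability.LatticeModels.CollarLegModel.ofDomain (V n)).Z‖) - (∑ i₁ : Fin k, ∑ i₂ ∈
    Finset.univ.filter (fun i₂ : Fin k ↦ i₁ < i₂), (-((if i₁ = j then (1 - (L j : ℝ)) else (L i₁ : ℝ)) * (if i₂
    = j then (1 - (L j : ℝ)) else (L i₂ : ℝ))) / 6) * Real.log
    (Literature.Probability.LatticeModels.dirichletGreen ((V n).image (fun v : ℤ × ℤ ↦ (![v.1, v.2] : Fin 2 →
    ℤ))) (![(((Function.update p i (p i + τ))) i₁).1, (((Function.update p i (p i + τ))) i₁).2] : Fin 2 → ℤ)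
    (![(((Function.update p i (p i + τ))) i₂).1, (((Function.update p i (p i + τ))) i₂).2] : Fin 2 → ℤ)))) -
    (Real.log (‖Literature.Probability.LatticeModels.CollarLegModel.Zins (V n) (⟨(Finset.univ.erase j).image
    (p), fun v ↦ ∑ b ∈ (Finset.univ.erase j).filter (fun b ↦ (p) b = v), L b, (p) j⟩ :
    Literature.Probability.LatticeModels.CollarLegModel.LegInsertionData)‖ /
    ‖(Literature.Probability.LatticeModels.CollarLegModel.ofDomain (V n)).Z‖) - (∑ i₁ : Fin k, ∑ i₂ ∈
    Finset.univ.filter (fun i₂ : Fin k ↦ i₁ < i₂), (-((if i₁ = j then (1 - (L j : ℝ)) else (L i₁ : ℝ)) * (if i₂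
    = j then (1 - (L j : ℝ)) else (L i₂ : ℝ))) / 6) * Real.log
    (Literature.Probability.LatticeModels.dirichletGreen ((V n).image (fun v : ℤ × ℤ ↦ (![v.1, v.2] : Fin 2 →
    ℤ))) (![((p) i₁).1, ((p) i₁).2] : Fin 2 → ℤ) (![((p) i₂).1, ((p) i₂).2] : Fin 2 → ℤ))))| ≤ ε * δ n) ∧ (∀ (D
    : Literature.Probability.RandomPlanarGeometry.JordanDomain), (∃ S : Finset (ℂ × ℂ), (∀ q ∈ S, q.1.re =
    q.2.re ∨ q.1.im = q.2.im) ∧ frontier D.carrier ⊆ ⋃ q ∈ S, segment ℝ q.1 q.2) → ∀ (r ε : ℝ), 0 < r → 0 < ε →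
    ∃ ρ : ℝ, 0 < ρ ∧ ρ ≤ r ∧ ∀ (δ : ℕ → ℝ), (∀ n, 0 < δ n) → Filter.Tendsto δ Filter.atTop (nhds 0) → ∀ (V : ℕ →
    Finset (ℤ × ℤ)), (∀ n, ∀ v : ℤ × ℤ, v ∈ V n ↔ (((v).1 : ℂ) * ((δ n : ℝ) : ℂ) + ((v).2 : ℂ) * ((δ n : ℝ) : ℂ)
    * Complex.I) ∈ closure D.carrier) → ∀ᶠ n in Filter.atTop, ∀ (p : Fin k → ℤ × ℤ) (i : Fin k) (q : ℤ × ℤ),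
    Function.Injective p → Function.Injective (Function.update p i q) →
    Literature.Probability.LatticeModels.CollarLegModel.LegInsertionData.IsAdmissible (⟨(Finset.univ.erase
    j).image (p), fun v ↦ ∑ b ∈ (Finset.univ.erase j).filter (fun b ↦ (p) b = v), L b, (p) j⟩ :
    Literature.Probability.LatticeModels.CollarLegModel.LegInsertionData) (V n) →
    Literature.Probability.LatticeModels.CollarLegModel.LegInsertionData.IsAdmissible (⟨(Finset.univ.erase
    j).image ((Function.update p i q)), fun v ↦ ∑ b ∈ (Finset.univ.erase j).filter (fun b ↦ ((Function.update p
    i q)) b = v), L b, ((Function.update p i q)) j⟩ :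
    Literature.Probability.LatticeModels.CollarLegModel.LegInsertionData) (V n) → 0 <
    (‖Literature.Probability.LatticeModels.CollarLegModel.Zins (V n) (⟨(Finset.univ.erase j).image (p), fun v ↦
    ∑ b ∈ (Finset.univ.erase j).filter (fun b ↦ (p) b = v), L b, (p) j⟩ :
    Literature.Probability.LatticeModels.CollarLegModel.LegInsertionData)‖ /
    ‖(Literature.Probability.LatticeModels.CollarLegModel.ofDomain (V n)).Z‖) → 0 <
    (‖Literature.Probability.LatticeModels.CollarLegModel.Zins (V n) (⟨(Finset.univ.erase j).image
    ((Function.update p i q)), fun v ↦ ∑ b ∈ (Finset.univ.erase j).filter (fun b ↦ ((Function.update p i q)) b =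
    v), L b, ((Function.update p i q)) j⟩ :
    Literature.Probability.LatticeModels.CollarLegModel.LegInsertionData)‖ /
    ‖(Literature.Probability.LatticeModels.CollarLegModel.ofDomain (V n)).Z‖) → (∀ i', i' ≠ i → (∃ d : ℤ × ℤ, (d
    = (1, 0) ∨ d = (-1, 0) ∨ d = (0, 1) ∨ d = (0, -1)) ∧ ∀ v : ℤ × ℤ, (((((v).1 - (p i').1) ^ 2 + ((v).2 - (p
    i').2) ^ 2 : ℤ) : ℝ)) ≤ (r / δ n) ^ 2 → (v ∈ V n ↔ 0 ≤ (v.1 - (p i').1) * d.1 + (v.2 - (p i').2) * d.2))) →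
    (∃ d : ℤ × ℤ, (d = (1, 0) ∨ d = (-1, 0) ∨ d = (0, 1) ∨ d = (0, -1)) ∧ ∀ v : ℤ × ℤ, (((((v).1 - (p i).1) ^ 2
    + ((v).2 - (p i).2) ^ 2 : ℤ) : ℝ)) ≤ (ρ / 4 / δ n) ^ 2 → (v ∈ V n ↔ 0 ≤ (v.1 - (p i).1) * d.1 + (v.2 - (p
    i).2) * d.2)) → (∃ d : ℤ × ℤ, (d = (1, 0) ∨ d = (-1, 0) ∨ d = (0, 1) ∨ d = (0, -1)) ∧ ∀ v : ℤ × ℤ, (((((v).1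
    - (q).1) ^ 2 + ((v).2 - (q).2) ^ 2 : ℤ) : ℝ)) ≤ (ρ / 4 / δ n) ^ 2 → (v ∈ V n ↔ 0 ≤ (v.1 - (q).1) * d.1 +
    (v.2 - (q).2) * d.2)) → (∀ i₁ i₂ : Fin k, i₁ ≠ i₂ → (r / δ n) ^ 2 ≤ ((((((p) i₁).1 - ((p) i₂).1) ^ 2 + (((p)
    i₁).2 - ((p) i₂).2) ^ 2 : ℤ) : ℝ))) → (∀ i₁ i₂ : Fin k, i₁ ≠ i₂ → (r / δ n) ^ 2 ≤ (((((((Function.update p i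
    q)) i₁).1 - (((Function.update p i q)) i₂).1) ^ 2 + ((((Function.update p i q)) i₁).2 - (((Function.update p
    i q)) i₂).2) ^ 2 : ℤ) : ℝ))) → (((((q).1 - (p i).1) ^ 2 + ((q).2 - (p i).2) ^ 2 : ℤ) : ℝ)) ≤ (ρ / δ n) ^ 2 →
    |(Real.log (‖Literature.Probability.LatticeModels.CollarLegModel.Zins (V n) (⟨(Finset.univ.erase j).image
    ((Function.update p i q)), fun v ↦ ∑ b ∈ (Finset.univ.erase j).filter (fun b ↦ ((Function.update p i q)) b =
    v), L b, ((Function.update p i q)) j⟩ :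
    Literature.Probability.LatticeModels.CollarLegModel.LegInsertionData)‖ /
    ‖(Literature.Probability.LatticeModels.CollarLegModel.ofDomain (V n)).Z‖) - (∑ i₁ : Fin k, ∑ i₂ ∈
    Finset.univ.filter (fun i₂ : Fin k ↦ i₁ < i₂), (-((if i₁ = j then (1 - (L j : ℝ)) else (L i₁ : ℝ)) * (if i₂
    = j then (1 - (L j : ℝ)) else (L i₂ : ℝ))) / 6) * Real.log
    (Literature.Probability.LatticeModels.dirichletGreen ((V n).image (fun v : ℤ × ℤ ↦ (![v.1, v.2] : Fin 2 →
    ℤ))) (![(((Function.update p i q)) i₁).1, (((Function.update p i q)) i₁).2] : Fin 2 → ℤ)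
    (![(((Function.update p i q)) i₂).1, (((Function.update p i q)) i₂).2] : Fin 2 → ℤ)))) - (Real.log
    (‖Literature.Probability.LatticeModels.CollarLegModel.Zins (V n) (⟨(Finset.univ.erase j).image (p), fun v ↦
    ∑ b ∈ (Finset.univ.erase j).filter (fun b ↦ (p) b = v), L b, (p) j⟩ :
    Literature.Probability.LatticeModels.CollarLegModel.LegInsertionData)‖ /
    ‖(Literature.Probability.LatticeModels.CollarLegModel.ofDomain (V n)).Z‖) - (∑ i₁ : Fin k, ∑ i₂ ∈
    Finset.univ.filter (fun i₂ : Fin k ↦ i₁ < i₂), (-((if i₁ = j then (1 - (L j : ℝ)) else (L i₁ : ℝ)) * (if i₂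
    = j then (1 - (L j : ℝ)) else (L i₂ : ℝ))) / 6) * Real.log
    (Literature.Probability.LatticeModels.dirichletGreen ((V n).image (fun v : ℤ × ℤ ↦ (![v.1, v.2] : Fin 2 →
    ℤ))) (![((p) i₁).1, ((p) i₁).2] : Fin 2 → ℤ) (![((p) i₂).1, ((p) i₂).2] : Fin 2 → ℤ))))| ≤ ε)) → (∀ (k : ℕ)
    (L : Fin k → ℕ) (j : Fin k), L j = ∑ i ∈ Finset.univ.erase j, L i → ∀ ε : ℝ, 0 < ε → ∃ M : ℝ, 0 < M ∧ ∀ (V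
    V' : Finset (ℤ × ℤ)) (a a' : ℤ × ℤ) (m : ℝ), 1 ≤ m → (∀ v : ℤ × ℤ, (((((v).1 - (a).1) ^ 2 + ((v).2 - (a).2)
    ^ 2 : ℤ) : ℝ)) ≤ (M * m) ^ 2 → (v ∈ V ↔ 0 ≤ v.2 - (a).2)) → (∀ v : ℤ × ℤ, (((((v).1 - (a').1) ^ 2 + ((v).2 -
    (a').2) ^ 2 : ℤ) : ℝ)) ≤ (M * m) ^ 2 → (v ∈ V' ↔ 0 ≤ v.2 - (a').2)) → ∀ (p : Fin k → ℤ × ℤ),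
    Function.Injective p → (∀ i, (((((p i).1 - (a).1) ^ 2 + ((p i).2 - (a).2) ^ 2 : ℤ) : ℝ)) ≤ m ^ 2) →
    Literature.Probability.LatticeModels.CollarLegModel.LegInsertionData.IsAdmissible (⟨(Finset.univ.erase
    j).image (p), fun v ↦ ∑ b ∈ (Finset.univ.erase j).filter (fun b ↦ (p) b = v), L b, (p) j⟩ :
    Literature.Probability.LatticeModels.CollarLegModel.LegInsertionData) (V) →
    Literature.Probability.LatticeModels.CollarLegModel.LegInsertionData.IsAdmissible (⟨(Finset.univ.erase
    j).image ((fun i ↦ p i - a + a')), fun v ↦ ∑ b ∈ (Finset.univ.erase j).filter (fun b ↦ ((fun i ↦ p i - a +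
    a')) b = v), L b, ((fun i ↦ p i - a + a')) j⟩ :
    Literature.Probability.LatticeModels.CollarLegModel.LegInsertionData) (V') → 0 <
    (‖Literature.Probability.LatticeModels.CollarLegModel.Zins (V) (⟨(Finset.univ.erase j).image (p), fun v ↦ ∑
    b ∈ (Finset.univ.erase j).filter (fun b ↦ (p) b = v), L b, (p) j⟩ :
    Literature.Probability.LatticeModels.CollarLegModel.LegInsertionData)‖ /
    ‖(Literature.Probability.LatticeModels.CollarLegModel.ofDomain (V)).Z‖) → 0 <
    (‖Literature.Probability.LatticeModels.CollarLegModel.Zins (V') (⟨(Finset.univ.erase j).image ((fun i ↦ p i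
    - a + a')), fun v ↦ ∑ b ∈ (Finset.univ.erase j).filter (fun b ↦ ((fun i ↦ p i - a + a')) b = v), L b, ((fun
    i ↦ p i - a + a')) j⟩ : Literature.Probability.LatticeModels.CollarLegModel.LegInsertionData)‖ /
    ‖(Literature.Probability.LatticeModels.CollarLegModel.ofDomain (V')).Z‖) → |(Real.log
    (‖Literature.Probability.LatticeModels.CollarLegModel.Zins (V) (⟨(Finset.univ.erase j).image (p), fun v ↦ ∑
    b ∈ (Finset.univ.erase j).filter (fun b ↦ (p) b = v), L b, (p) j⟩ :
    Literature.Probability.LatticeModels.CollarLegModel.LegInsertionData)‖ /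
    ‖(Literature.Probability.LatticeModels.CollarLegModel.ofDomain (V)).Z‖) - (∑ i₁ : Fin k, ∑ i₂ ∈
    Finset.univ.filter (fun i₂ : Fin k ↦ i₁ < i₂), (-((if i₁ = j then (1 - (L j : ℝ)) else (L i₁ : ℝ)) * (if i₂
    = j then (1 - (L j : ℝ)) else (L i₂ : ℝ))) / 6) * Real.log
    (Literature.Probability.LatticeModels.dirichletGreen ((V).image (fun v : ℤ × ℤ ↦ (![v.1, v.2] : Fin 2 → ℤ)))
    (![((p) i₁).1, ((p) i₁).2] : Fin 2 → ℤ) (![((p) i₂).1, ((p) i₂).2] : Fin 2 → ℤ)))) - (Real.log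
    (‖Literature.Probability.LatticeModels.CollarLegModel.Zins (V') (⟨(Finset.univ.erase j).image ((fun i ↦ p i
    - a + a')), fun v ↦ ∑ b ∈ (Finset.univ.erase j).filter (fun b ↦ ((fun i ↦ p i - a + a')) b = v), L b, ((fun
    i ↦ p i - a + a')) j⟩ : Literature.Probability.LatticeModels.CollarLegModel.LegInsertionData)‖ /
    ‖(Literature.Probability.LatticeModels.CollarLegModel.ofDomain (V')).Z‖) - (∑ i₁ : Fin k, ∑ i₂ ∈
    Finset.univ.filter (fun i₂ : Fin k ↦ i₁ < i₂), (-((if i₁ = j then (1 - (L j : ℝ)) else (L i₁ : ℝ)) * (if i₂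
    = j then (1 - (L j : ℝ)) else (L i₂ : ℝ))) / 6) * Real.log
    (Literature.Probability.LatticeModels.dirichletGreen ((V').image (fun v : ℤ × ℤ ↦ (![v.1, v.2] : Fin 2 →
    ℤ))) (![(((fun i ↦ p i - a + a')) i₁).1, (((fun i ↦ p i - a + a')) i₁).2] : Fin 2 → ℤ) (![(((fun i ↦ p i - a
    + a')) i₂).1, (((fun i ↦ p i - a + a')) i₂).2] : Fin 2 → ℤ))))| ≤ ε) → ∀ (k : ℕ) (L : Fin k → ℕ) (j : Fin
    k), L j = ∑ i ∈ Finset.univ.erase j, L i → ∀ (D D' :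
    Literature.Probability.RandomPlanarGeometry.MarkedDomain k), (∃ S : Finset (ℂ × ℂ), (∀ q ∈ S, q.1.re =
    q.2.re ∨ q.1.im = q.2.im) ∧ frontier D.carrier ⊆ ⋃ q ∈ S, segment ℝ q.1 q.2) → (∀ i, (∃ r : ℝ, 0 < r ∧ ((∀ z
    ∈ frontier D.carrier, dist z (D.pt i) < r → z.im = (D.pt i).im) ∨ (∀ z ∈ frontier D.carrier, dist z (D.pt i)
    < r → z.re = (D.pt i).re)))) → (∃ τ : ℂ, ‖τ‖ = 1 ∧ (∃ ε : ℝ, 0 < ε ∧ ∀ t ∈ Set.Ioo (D.mark j) (D.mark j +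
    ε), ∃ s : ℝ, 0 < s ∧ D.boundary t = D.pt j + (s : ℂ) * τ) ∧ (∃ ε : ℝ, 0 < ε ∧ ∀ s ∈ Set.Ioo (0 : ℝ) ε, D.pt
    j + (s : ℂ) * (τ * Complex.I) ∈ D.carrier)) → (∃ S : Finset (ℂ × ℂ), (∀ q ∈ S, q.1.re = q.2.re ∨ q.1.im =
    q.2.im) ∧ frontier D'.carrier ⊆ ⋃ q ∈ S, segment ℝ q.1 q.2) → (∀ i, (∃ r : ℝ, 0 < r ∧ ((∀ z ∈ frontier
    D'.carrier, dist z (D'.pt i) < r → z.im = (D'.pt i).im) ∨ (∀ z ∈ frontier D'.carrier, dist z (D'.pt i) < r →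
    z.re = (D'.pt i).re)))) → (∃ τ : ℂ, ‖τ‖ = 1 ∧ (∃ ε : ℝ, 0 < ε ∧ ∀ t ∈ Set.Ioo (D'.mark j) (D'.mark j + ε), ∃
    s : ℝ, 0 < s ∧ D'.boundary t = D'.pt j + (s : ℂ) * τ) ∧ (∃ ε : ℝ, 0 < ε ∧ ∀ s ∈ Set.Ioo (0 : ℝ) ε, D'.pt j +
    (s : ℂ) * (τ * Complex.I) ∈ D'.carrier)) → ∀ (δ : ℕ → ℝ), (∀ n, 0 < δ n) → Filter.Tendsto δ Filter.atTop
    (nhds 0) → ∀ (V V' : ℕ → Finset (ℤ × ℤ)), (∀ n, ∀ v : ℤ × ℤ, v ∈ V n ↔ (((v).1 : ℂ) * ((δ n : ℝ) : ℂ) +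
    ((v).2 : ℂ) * ((δ n : ℝ) : ℂ) * Complex.I) ∈ closure D.carrier) → (∀ n, ∀ v : ℤ × ℤ, v ∈ V' n ↔ (((v).1 : ℂ)
    * ((δ n : ℝ) : ℂ) + ((v).2 : ℂ) * ((δ n : ℝ) : ℂ) * Complex.I) ∈ closure D'.carrier) → ∀ (p p' : ℕ → Fin k →
    ℤ × ℤ), (∀ n, Function.Injective ((p) n)) → (∀ n, Function.Injective ((p') n)) → (∀ i, Filter.Tendsto (fun n
    ↦ ((((p) n i).1 : ℂ) * ((δ n : ℝ) : ℂ) + (((p) n i).2 : ℂ) * ((δ n : ℝ) : ℂ) * Complex.I)) Filter.atTop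
    (nhds (D.pt i))) → (∀ i, Filter.Tendsto (fun n ↦ ((((p') n i).1 : ℂ) * ((δ n : ℝ) : ℂ) + (((p') n i).2 : ℂ)
    * ((δ n : ℝ) : ℂ) * Complex.I)) Filter.atTop (nhds (D'.pt i))) → (∀ n,
    Literature.Probability.LatticeModels.CollarLegModel.LegInsertionData.IsAdmissible (⟨(Finset.univ.erase
    j).image ((p) n), fun v ↦ ∑ b ∈ (Finset.univ.erase j).filter (fun b ↦ ((p) n) b = v), L b, ((p) n) j⟩ :
    Literature.Probability.LatticeModels.CollarLegModel.LegInsertionData) (V n)) → (∀ n,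
    Literature.Probability.LatticeModels.CollarLegModel.LegInsertionData.IsAdmissible (⟨(Finset.univ.erase
    j).image ((p') n), fun v ↦ ∑ b ∈ (Finset.univ.erase j).filter (fun b ↦ ((p') n) b = v), L b, ((p') n) j⟩ :
    Literature.Probability.LatticeModels.CollarLegModel.LegInsertionData) (V' n)) → (∀ᶠ n in Filter.atTop, 0 <
    (‖Literature.Probability.LatticeModels.CollarLegModel.Zins (V n) (⟨(Finset.univ.erase j).image (p n), fun v
    ↦ ∑ b ∈ (Finset.univ.erase j).filter (fun b ↦ (p n) b = v), L b, (p n) j⟩ :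
    Literature.Probability.LatticeModels.CollarLegModel.LegInsertionData)‖ /
    ‖(Literature.Probability.LatticeModels.CollarLegModel.ofDomain (V n)).Z‖)) ∧ Filter.Tendsto (fun n ↦
    (Real.log (‖Literature.Probability.LatticeModels.CollarLegModel.Zins (V n) (⟨(Finset.univ.erase j).image (p
    n), fun v ↦ ∑ b ∈ (Finset.univ.erase j).filter (fun b ↦ (p n) b = v), L b, (p n) j⟩ :
    Literature.Probability.LatticeModels.CollarLegModel.LegInsertionData)‖ /
    ‖(Literature.Probability.LatticeModels.CollarLegModel.ofDomain (V n)).Z‖) - (∑ i₁ : Fin k, ∑ i₂ ∈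
    Finset.univ.filter (fun i₂ : Fin k ↦ i₁ < i₂), (-((if i₁ = j then (1 - (L j : ℝ)) else (L i₁ : ℝ)) * (if i₂
    = j then (1 - (L j : ℝ)) else (L i₂ : ℝ))) / 6) * Real.log
    (Literature.Probability.LatticeModels.dirichletGreen ((V n).image (fun v : ℤ × ℤ ↦ (![v.1, v.2] : Fin 2 →
    ℤ))) (![((p n) i₁).1, ((p n) i₁).2] : Fin 2 → ℤ) (![((p n) i₂).1, ((p n) i₂).2] : Fin 2 → ℤ)))) - (Real.log
    (‖Literature.Probability.LatticeModels.CollarLegModel.Zins (V' n) (⟨(Finset.univ.erase j).image (p' n), fun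
    v ↦ ∑ b ∈ (Finset.univ.erase j).filter (fun b ↦ (p' n) b = v), L b, (p' n) j⟩ :
    Literature.Probability.LatticeModels.CollarLegModel.LegInsertionData)‖ /
    ‖(Literature.Probability.LatticeModels.CollarLegModel.ofDomain (V' n)).Z‖) - (∑ i₁ : Fin k, ∑ i₂ ∈
    Finset.univ.filter (fun i₂ : Fin k ↦ i₁ < i₂), (-((if i₁ = j then (1 - (L j : ℝ)) else (L i₁ : ℝ)) * (if i₂
    = j then (1 - (L j : ℝ)) else (L i₂ : ℝ))) / 6) * Real.log
    (Literature.Probability.LatticeModels.dirichletGreen ((V' n).image (fun v : ℤ × ℤ ↦ (![v.1, v.2] : Fin 2 →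
    ℤ))) (![((p' n) i₁).1, ((p' n) i₁).2] : Fin 2 → ℤ) (![((p' n) i₂).1, ((p' n) i₂).2] : Fin 2 → ℤ)))))
    Filter.atTop (nhds 0) := by
  sorry

/-! ### Stub 4 — REFERENCE LIMIT (sharpness content) -/

/-- **Stub 4 — reference limit (the sharpness content).** For every leg family there is ONE
rectilinear marked domain `D₀` (non-corner marks, positively oriented at the sink) which (i) is
approximable: along every mesh sequence there are injective lattice configurations `p_n → D₀.pt`,
admissible from some index on; and (ii) has a limit: `F_{V_n}(p_n) → ℓ` for every admissible injective
`p_n → D₀.pt`. With Stub 3 this is (GM) with `C′ = e^ℓ`; it is where the crux's SHARP normalisation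
lives (Disproof §9 `sharpTwoPoint_of_twoPointLaw`, §11: on 𝕋 such sharp arm asymptotics are theorems,
Du–Gao–Li–Zhuang 2024; on ℤ² open). A worker picks the easiest `D₀` (e.g. a square with the marks on
the bottom side). Size: L–XL. [folklore] -/
theorem stub_referenceLimit :
    ∀ (k : ℕ) (L : Fin k → ℕ) (j : Fin k), L j = ∑ i ∈ Finset.univ.erase j, L i → ∃ D₀ :
    Literature.Probability.RandomPlanarGeometry.MarkedDomain k, (∃ S : Finset (ℂ × ℂ), (∀ q ∈ S, q.1.re = q.2.re
    ∨ q.1.im = q.2.im) ∧ frontier D₀.carrier ⊆ ⋃ q ∈ S, segment ℝ q.1 q.2) ∧ (∀ i, (∃ r : ℝ, 0 < r ∧ ((∀ z ∈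
    frontier D₀.carrier, dist z (D₀.pt i) < r → z.im = (D₀.pt i).im) ∨ (∀ z ∈ frontier D₀.carrier, dist z (D₀.pt
    i) < r → z.re = (D₀.pt i).re)))) ∧ (∃ τ : ℂ, ‖τ‖ = 1 ∧ (∃ ε : ℝ, 0 < ε ∧ ∀ t ∈ Set.Ioo (D₀.mark j) (D₀.mark
    j + ε), ∃ s : ℝ, 0 < s ∧ D₀.boundary t = D₀.pt j + (s : ℂ) * τ) ∧ (∃ ε : ℝ, 0 < ε ∧ ∀ s ∈ Set.Ioo (0 : ℝ) ε,
    D₀.pt j + (s : ℂ) * (τ * Complex.I) ∈ D₀.carrier)) ∧ (∀ (δ : ℕ → ℝ), (∀ n, 0 < δ n) → Filter.Tendsto δ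
    Filter.atTop (nhds 0) → ∀ (V : ℕ → Finset (ℤ × ℤ)), (∀ n, ∀ v : ℤ × ℤ, v ∈ V n ↔ (((v).1 : ℂ) * ((δ n : ℝ) :
    ℂ) + ((v).2 : ℂ) * ((δ n : ℝ) : ℂ) * Complex.I) ∈ closure D₀.carrier) → ∃ p : ℕ → Fin k → ℤ × ℤ, (∀ n,
    Function.Injective ((p) n)) ∧ (∀ i, Filter.Tendsto (fun n ↦ ((((p) n i).1 : ℂ) * ((δ n : ℝ) : ℂ) + (((p) n
    i).2 : ℂ) * ((δ n : ℝ) : ℂ) * Complex.I)) Filter.atTop (nhds (D₀.pt i))) ∧ ∃ N : ℕ, ∀ n, N ≤ n →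
    Literature.Probability.LatticeModels.CollarLegModel.LegInsertionData.IsAdmissible (⟨(Finset.univ.erase
    j).image (p n), fun v ↦ ∑ b ∈ (Finset.univ.erase j).filter (fun b ↦ (p n) b = v), L b, (p n) j⟩ :
    Literature.Probability.LatticeModels.CollarLegModel.LegInsertionData) (V n)) ∧ ∃ ℓ : ℝ, ∀ (δ : ℕ → ℝ), (∀ n,
    0 < δ n) → Filter.Tendsto δ Filter.atTop (nhds 0) → ∀ (V : ℕ → Finset (ℤ × ℤ)), (∀ n, ∀ v : ℤ × ℤ, v ∈ V n ↔
    (((v).1 : ℂ) * ((δ n : ℝ) : ℂ) + ((v).2 : ℂ) * ((δ n : ℝ) : ℂ) * Complex.I) ∈ closure D₀.carrier) → ∀ (p : ℕ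
    → Fin k → ℤ × ℤ), (∀ n, Function.Injective ((p) n)) → (∀ i, Filter.Tendsto (fun n ↦ ((((p) n i).1 : ℂ) * ((δ
    n : ℝ) : ℂ) + (((p) n i).2 : ℂ) * ((δ n : ℝ) : ℂ) * Complex.I)) Filter.atTop (nhds (D₀.pt i))) → (∀ n,
    Literature.Probability.LatticeModels.CollarLegModel.LegInsertionData.IsAdmissible (⟨(Finset.univ.erase
    j).image ((p) n), fun v ↦ ∑ b ∈ (Finset.univ.erase j).filter (fun b ↦ ((p) n) b = v), L b, ((p) n) j⟩ :
    Literature.Probability.LatticeModels.CollarLegModel.LegInsertionData) (V n)) → Filter.Tendsto (fun n ↦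
    (Real.log (‖Literature.Probability.LatticeModels.CollarLegModel.Zins (V n) (⟨(Finset.univ.erase j).image (p
    n), fun v ↦ ∑ b ∈ (Finset.univ.erase j).filter (fun b ↦ (p n) b = v), L b, (p n) j⟩ :
    Literature.Probability.LatticeModels.CollarLegModel.LegInsertionData)‖ /
    ‖(Literature.Probability.LatticeModels.CollarLegModel.ofDomain (V n)).Z‖) - (∑ i₁ : Fin k, ∑ i₂ ∈
    Finset.univ.filter (fun i₂ : Fin k ↦ i₁ < i₂), (-((if i₁ = j then (1 - (L j : ℝ)) else (L i₁ : ℝ)) * (if i₂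
    = j then (1 - (L j : ℝ)) else (L i₂ : ℝ))) / 6) * Real.log
    (Literature.Probability.LatticeModels.dirichletGreen ((V n).image (fun v : ℤ × ℤ ↦ (![v.1, v.2] : Fin 2 →
    ℤ))) (![((p n) i₁).1, ((p n) i₁).2] : Fin 2 → ℤ) (![((p n) i₂).1, ((p n) i₂).2] : Fin 2 → ℤ)))))
    Filter.atTop (nhds ℓ) := by
  sorry

/-! ### Stub 5 — GREEN KERNEL ASYMPTOTICS at flat edges -/

/-- **Stub 5 — Green kernel asymptotics at flat edges (classical discrete potential theory).** There
is a universal `c > 0` (lattice constant of the flat edge of `ℤ²`) such that for every rectilinear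
Jordan domain `D`, distinct non-corner boundary points `x, y`, any uniformizing map `w` (holomorphic
on a neighbourhood of `D̄` near `x, y`, bijective `D → ℍ`; the right side is Möbius-invariant, so no
frame or orientation condition is needed), mesh `δ_n → 0⁺`, and flat boundary lattice points
`a_n → x`, `b_n → y` of `V_n` (exactly one lattice neighbour outside `V_n`):
`G_{V_n}(a_n,b_n)/δ_n² → c·|w′(x)||w′(y)|/|w(x) − w(y)|²` (`= cπ ×` the excursion Poisson kernel
`H_∂D(x,y)`; half-plane check by reflection: `G(0,r) ≈ 4/(πr²)` in Lawler's normalisation, triage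
r1-1). Proof: image reflection across the flat edge + interior convergence of discrete harmonic
functions in polygons. Size: L (provable now). [folklore] -/
theorem stub_greenKernelAsymptotics :
    ∃ c : ℝ, 0 < c ∧ ∀ (D : Literature.Probability.RandomPlanarGeometry.JordanDomain), (∃ S : Finset (ℂ × ℂ), (∀
    q ∈ S, q.1.re = q.2.re ∨ q.1.im = q.2.im) ∧ frontier D.carrier ⊆ ⋃ q ∈ S, segment ℝ q.1 q.2) → ∀ (x y : ℂ),
    x ∈ frontier D.carrier → y ∈ frontier D.carrier → x ≠ y → (∃ r : ℝ, 0 < r ∧ ((∀ z ∈ frontier D.carrier, dist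
    z (x) < r → z.im = (x).im) ∨ (∀ z ∈ frontier D.carrier, dist z (x) < r → z.re = (x).re))) → (∃ r : ℝ, 0 < r
    ∧ ((∀ z ∈ frontier D.carrier, dist z (y) < r → z.im = (y).im) ∨ (∀ z ∈ frontier D.carrier, dist z (y) < r →
    z.re = (y).re))) → ∀ (w : ℂ → ℂ) (U : Set ℂ), IsOpen U → D.carrier ⊆ U → x ∈ U → y ∈ U → DifferentiableOn ℂ
    w U → Set.BijOn w D.carrier {z : ℂ | 0 < z.im} → ∀ (δ : ℕ → ℝ), (∀ n, 0 < δ n) → Filter.Tendsto δ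
    Filter.atTop (nhds 0) → ∀ (V : ℕ → Finset (ℤ × ℤ)), (∀ n, ∀ v : ℤ × ℤ, v ∈ V n ↔ (((v).1 : ℂ) * ((δ n : ℝ) :
    ℂ) + ((v).2 : ℂ) * ((δ n : ℝ) : ℂ) * Complex.I) ∈ closure D.carrier) → ∀ (a b : ℕ → ℤ × ℤ), (∀ n, a n ∈ V n
    ∧ ((Literature.Probability.LatticeModels.CollarLegModel.neighbours (a n)).filter (fun u ↦ u ∉ V n)).card =
    1) → (∀ n, b n ∈ V n ∧ ((Literature.Probability.LatticeModels.CollarLegModel.neighbours (b n)).filter (fun u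
    ↦ u ∉ V n)).card = 1) → Filter.Tendsto (fun n ↦ (((a n).1 : ℂ) * ((δ n : ℝ) : ℂ) + ((a n).2 : ℂ) * ((δ n :
    ℝ) : ℂ) * Complex.I)) Filter.atTop (nhds x) → Filter.Tendsto (fun n ↦ (((b n).1 : ℂ) * ((δ n : ℝ) : ℂ) + ((b
    n).2 : ℂ) * ((δ n : ℝ) : ℂ) * Complex.I)) Filter.atTop (nhds y) → Filter.Tendsto (fun n ↦
    (Literature.Probability.LatticeModels.dirichletGreen ((V n).image (fun v : ℤ × ℤ ↦ (![v.1, v.2] : Fin 2 →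
    ℤ))) (![(a n).1, (a n).2] : Fin 2 → ℤ) (![(b n).1, (b n).2] : Fin 2 → ℤ)) / (δ n) ^ 2) Filter.atTop (nhds (c
    * (‖deriv w x‖ * ‖deriv w y‖ / ‖w x - w y‖ ^ 2))) := by
  sorry

/-! ### Stub 6 — TRANSFER to the crux (limit algebra + orientation lemma) -/

/-- **Stub 6 — transfer (limit algebra).** RIGIDITY → REFERENCE LIMIT → GREEN KERNEL ASYMPTOTICS →
the crux `BoundaryDefectGaussianR` BY NAME. Content: (i) orientation lemma — the crux's hypothesis
"`re ∘ w ∘ D.boundary` strictly increasing near each mark" for a holomorphic bijection `D → ℍ` gives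
"interior on the left" at the sink mark (local biholomorphy at a flat boundary point via Schwarz
reflection / identity theorem); (ii) flatness of admissible points (one outside neighbour) feeds Stub
5 for every pair; (iii) with `F_n → ℓ` (Stubs 3+4 along the crux's mesh sequence, reference data
shifted to start where admissible): `log(δ_n^{-Σh} P_n) = Σ_{i<i'}(−e_ie_i'/6) log(G/δ_n²) + F_n`
EXACTLY, because `2Σ_{i<i'}(−e_ie_i'/6) = Σ_i h(e_i)` at `Σe = 1` (`mesh_powers_cancel`); pass to the
limit, exponentiate, and rewrite `∏ K^{−e_ie_i'/6} = ∏|w_i − w_i'|^{e_ie_i'/3} ∏|w′_i|^{h(e_i)}` by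
`kac_from_pairs`; the constant is `C = e^ℓ · c^{Σ_{i<i'}(−e_ie_i'/6)}`, a function of `(k, L, j)`
only. Size: M–L (M for the algebra, L for (i) in Lean). [folklore] -/
theorem stub_transfer :
    (∀ (k : ℕ) (L : Fin k → ℕ) (j : Fin k), L j = ∑ i ∈ Finset.univ.erase j, L i → ∀ (D D' :
    Literature.Probability.RandomPlanarGeometry.MarkedDomain k), (∃ S : Finset (ℂ × ℂ), (∀ q ∈ S, q.1.re =
    q.2.re ∨ q.1.im = q.2.im) ∧ frontier D.carrier ⊆ ⋃ q ∈ S, segment ℝ q.1 q.2) → (∀ i, (∃ r : ℝ, 0 < r ∧ ((∀ z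
    ∈ frontier D.carrier, dist z (D.pt i) < r → z.im = (D.pt i).im) ∨ (∀ z ∈ frontier D.carrier, dist z (D.pt i)
    < r → z.re = (D.pt i).re)))) → (∃ τ : ℂ, ‖τ‖ = 1 ∧ (∃ ε : ℝ, 0 < ε ∧ ∀ t ∈ Set.Ioo (D.mark j) (D.mark j +
    ε), ∃ s : ℝ, 0 < s ∧ D.boundary t = D.pt j + (s : ℂ) * τ) ∧ (∃ ε : ℝ, 0 < ε ∧ ∀ s ∈ Set.Ioo (0 : ℝ) ε, D.pt
    j + (s : ℂ) * (τ * Complex.I) ∈ D.carrier)) → (∃ S : Finset (ℂ × ℂ), (∀ q ∈ S, q.1.re = q.2.re ∨ q.1.im =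
    q.2.im) ∧ frontier D'.carrier ⊆ ⋃ q ∈ S, segment ℝ q.1 q.2) → (∀ i, (∃ r : ℝ, 0 < r ∧ ((∀ z ∈ frontier
    D'.carrier, dist z (D'.pt i) < r → z.im = (D'.pt i).im) ∨ (∀ z ∈ frontier D'.carrier, dist z (D'.pt i) < r →
    z.re = (D'.pt i).re)))) → (∃ τ : ℂ, ‖τ‖ = 1 ∧ (∃ ε : ℝ, 0 < ε ∧ ∀ t ∈ Set.Ioo (D'.mark j) (D'.mark j + ε), ∃
    s : ℝ, 0 < s ∧ D'.boundary t = D'.pt j + (s : ℂ) * τ) ∧ (∃ ε : ℝ, 0 < ε ∧ ∀ s ∈ Set.Ioo (0 : ℝ) ε, D'.pt j +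
    (s : ℂ) * (τ * Complex.I) ∈ D'.carrier)) → ∀ (δ : ℕ → ℝ), (∀ n, 0 < δ n) → Filter.Tendsto δ Filter.atTop
    (nhds 0) → ∀ (V V' : ℕ → Finset (ℤ × ℤ)), (∀ n, ∀ v : ℤ × ℤ, v ∈ V n ↔ (((v).1 : ℂ) * ((δ n : ℝ) : ℂ) +
    ((v).2 : ℂ) * ((δ n : ℝ) : ℂ) * Complex.I) ∈ closure D.carrier) → (∀ n, ∀ v : ℤ × ℤ, v ∈ V' n ↔ (((v).1 : ℂ)
    * ((δ n : ℝ) : ℂ) + ((v).2 : ℂ) * ((δ n : ℝ) : ℂ) * Complex.I) ∈ closure D'.carrier) → ∀ (p p' : ℕ → Fin k →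
    ℤ × ℤ), (∀ n, Function.Injective ((p) n)) → (∀ n, Function.Injective ((p') n)) → (∀ i, Filter.Tendsto (fun n
    ↦ ((((p) n i).1 : ℂ) * ((δ n : ℝ) : ℂ) + (((p) n i).2 : ℂ) * ((δ n : ℝ) : ℂ) * Complex.I)) Filter.atTop
    (nhds (D.pt i))) → (∀ i, Filter.Tendsto (fun n ↦ ((((p') n i).1 : ℂ) * ((δ n : ℝ) : ℂ) + (((p') n i).2 : ℂ)
    * ((δ n : ℝ) : ℂ) * Complex.I)) Filter.atTop (nhds (D'.pt i))) → (∀ n,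
    Literature.Probability.LatticeModels.CollarLegModel.LegInsertionData.IsAdmissible (⟨(Finset.univ.erase
    j).image ((p) n), fun v ↦ ∑ b ∈ (Finset.univ.erase j).filter (fun b ↦ ((p) n) b = v), L b, ((p) n) j⟩ :
    Literature.Probability.LatticeModels.CollarLegModel.LegInsertionData) (V n)) → (∀ n,
    Literature.Probability.LatticeModels.CollarLegModel.LegInsertionData.IsAdmissible (⟨(Finset.univ.erase
    j).image ((p') n), fun v ↦ ∑ b ∈ (Finset.univ.erase j).filter (fun b ↦ ((p') n) b = v), L b, ((p') n) j⟩ :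
    Literature.Probability.LatticeModels.CollarLegModel.LegInsertionData) (V' n)) → (∀ᶠ n in Filter.atTop, 0 <
    (‖Literature.Probability.LatticeModels.CollarLegModel.Zins (V n) (⟨(Finset.univ.erase j).image (p n), fun v
    ↦ ∑ b ∈ (Finset.univ.erase j).filter (fun b ↦ (p n) b = v), L b, (p n) j⟩ :
    Literature.Probability.LatticeModels.CollarLegModel.LegInsertionData)‖ /
    ‖(Literature.Probability.LatticeModels.CollarLegModel.ofDomain (V n)).Z‖)) ∧ Filter.Tendsto (fun n ↦
    (Real.log (‖Literature.Probability.LatticeModels.CollarLegModel.Zins (V n) (⟨(Finset.univ.erase j).image (p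
    n), fun v ↦ ∑ b ∈ (Finset.univ.erase j).filter (fun b ↦ (p n) b = v), L b, (p n) j⟩ :
    Literature.Probability.LatticeModels.CollarLegModel.LegInsertionData)‖ /
    ‖(Literature.Probability.LatticeModels.CollarLegModel.ofDomain (V n)).Z‖) - (∑ i₁ : Fin k, ∑ i₂ ∈
    Finset.univ.filter (fun i₂ : Fin k ↦ i₁ < i₂), (-((if i₁ = j then (1 - (L j : ℝ)) else (L i₁ : ℝ)) * (if i₂
    = j then (1 - (L j : ℝ)) else (L i₂ : ℝ))) / 6) * Real.log
    (Literature.Probability.LatticeModels.dirichletGreen ((V n).image (fun v : ℤ × ℤ ↦ (![v.1, v.2] : Fin 2 →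
    ℤ))) (![((p n) i₁).1, ((p n) i₁).2] : Fin 2 → ℤ) (![((p n) i₂).1, ((p n) i₂).2] : Fin 2 → ℤ)))) - (Real.log
    (‖Literature.Probability.LatticeModels.CollarLegModel.Zins (V' n) (⟨(Finset.univ.erase j).image (p' n), fun
    v ↦ ∑ b ∈ (Finset.univ.erase j).filter (fun b ↦ (p' n) b = v), L b, (p' n) j⟩ :
    Literature.Probability.LatticeModels.CollarLegModel.LegInsertionData)‖ /
    ‖(Literature.Probability.LatticeModels.CollarLegModel.ofDomain (V' n)).Z‖) - (∑ i₁ : Fin k, ∑ i₂ ∈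
    Finset.univ.filter (fun i₂ : Fin k ↦ i₁ < i₂), (-((if i₁ = j then (1 - (L j : ℝ)) else (L i₁ : ℝ)) * (if i₂
    = j then (1 - (L j : ℝ)) else (L i₂ : ℝ))) / 6) * Real.log
    (Literature.Probability.LatticeModels.dirichletGreen ((V' n).image (fun v : ℤ × ℤ ↦ (![v.1, v.2] : Fin 2 →
    ℤ))) (![((p' n) i₁).1, ((p' n) i₁).2] : Fin 2 → ℤ) (![((p' n) i₂).1, ((p' n) i₂).2] : Fin 2 → ℤ)))))
    Filter.atTop (nhds 0)) → (∀ (k : ℕ) (L : Fin k → ℕ) (j : Fin k), L j = ∑ i ∈ Finset.univ.erase j, L i → ∃ D₀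
    : Literature.Probability.RandomPlanarGeometry.MarkedDomain k, (∃ S : Finset (ℂ × ℂ), (∀ q ∈ S, q.1.re =
    q.2.re ∨ q.1.im = q.2.im) ∧ frontier D₀.carrier ⊆ ⋃ q ∈ S, segment ℝ q.1 q.2) ∧ (∀ i, (∃ r : ℝ, 0 < r ∧ ((∀
    z ∈ frontier D₀.carrier, dist z (D₀.pt i) < r → z.im = (D₀.pt i).im) ∨ (∀ z ∈ frontier D₀.carrier, dist z
    (D₀.pt i) < r → z.re = (D₀.pt i).re)))) ∧ (∃ τ : ℂ, ‖τ‖ = 1 ∧ (∃ ε : ℝ, 0 < ε ∧ ∀ t ∈ Set.Ioo (D₀.mark j)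
    (D₀.mark j + ε), ∃ s : ℝ, 0 < s ∧ D₀.boundary t = D₀.pt j + (s : ℂ) * τ) ∧ (∃ ε : ℝ, 0 < ε ∧ ∀ s ∈ Set.Ioo
    (0 : ℝ) ε, D₀.pt j + (s : ℂ) * (τ * Complex.I) ∈ D₀.carrier)) ∧ (∀ (δ : ℕ → ℝ), (∀ n, 0 < δ n) →
    Filter.Tendsto δ Filter.atTop (nhds 0) → ∀ (V : ℕ → Finset (ℤ × ℤ)), (∀ n, ∀ v : ℤ × ℤ, v ∈ V n ↔ (((v).1 :
    ℂ) * ((δ n : ℝ) : ℂ) + ((v).2 : ℂ) * ((δ n : ℝ) : ℂ) * Complex.I) ∈ closure D₀.carrier) → ∃ p : ℕ → Fin k →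
    ℤ × ℤ, (∀ n, Function.Injective ((p) n)) ∧ (∀ i, Filter.Tendsto (fun n ↦ ((((p) n i).1 : ℂ) * ((δ n : ℝ) :
    ℂ) + (((p) n i).2 : ℂ) * ((δ n : ℝ) : ℂ) * Complex.I)) Filter.atTop (nhds (D₀.pt i))) ∧ ∃ N : ℕ, ∀ n, N ≤ n
    → Literature.Probability.LatticeModels.CollarLegModel.LegInsertionData.IsAdmissible (⟨(Finset.univ.erase
    j).image (p n), fun v ↦ ∑ b ∈ (Finset.univ.erase j).filter (fun b ↦ (p n) b = v), L b, (p n) j⟩ :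
    Literature.Probability.LatticeModels.CollarLegModel.LegInsertionData) (V n)) ∧ ∃ ℓ : ℝ, ∀ (δ : ℕ → ℝ), (∀ n,
    0 < δ n) → Filter.Tendsto δ Filter.atTop (nhds 0) → ∀ (V : ℕ → Finset (ℤ × ℤ)), (∀ n, ∀ v : ℤ × ℤ, v ∈ V n ↔
    (((v).1 : ℂ) * ((δ n : ℝ) : ℂ) + ((v).2 : ℂ) * ((δ n : ℝ) : ℂ) * Complex.I) ∈ closure D₀.carrier) → ∀ (p : ℕ
    → Fin k → ℤ × ℤ), (∀ n, Function.Injective ((p) n)) → (∀ i, Filter.Tendsto (fun n ↦ ((((p) n i).1 : ℂ) * ((δ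
    n : ℝ) : ℂ) + (((p) n i).2 : ℂ) * ((δ n : ℝ) : ℂ) * Complex.I)) Filter.atTop (nhds (D₀.pt i))) → (∀ n,
    Literature.Probability.LatticeModels.CollarLegModel.LegInsertionData.IsAdmissible (⟨(Finset.univ.erase
    j).image ((p) n), fun v ↦ ∑ b ∈ (Finset.univ.erase j).filter (fun b ↦ ((p) n) b = v), L b, ((p) n) j⟩ :
    Literature.Probability.LatticeModels.CollarLegModel.LegInsertionData) (V n)) → Filter.Tendsto (fun n ↦
    (Real.log (‖Literature.Probability.LatticeModels.CollarLegModel.Zins (V n) (⟨(Finset.univ.erase j).image (p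
    n), fun v ↦ ∑ b ∈ (Finset.univ.erase j).filter (fun b ↦ (p n) b = v), L b, (p n) j⟩ :
    Literature.Probability.LatticeModels.CollarLegModel.LegInsertionData)‖ /
    ‖(Literature.Probability.LatticeModels.CollarLegModel.ofDomain (V n)).Z‖) - (∑ i₁ : Fin k, ∑ i₂ ∈
    Finset.univ.filter (fun i₂ : Fin k ↦ i₁ < i₂), (-((if i₁ = j then (1 - (L j : ℝ)) else (L i₁ : ℝ)) * (if i₂
    = j then (1 - (L j : ℝ)) else (L i₂ : ℝ))) / 6) * Real.log
    (Literature.Probability.LatticeModels.dirichletGreen ((V n).image (fun v : ℤ × ℤ ↦ (![v.1, v.2] : Fin 2 →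
    ℤ))) (![((p n) i₁).1, ((p n) i₁).2] : Fin 2 → ℤ) (![((p n) i₂).1, ((p n) i₂).2] : Fin 2 → ℤ)))))
    Filter.atTop (nhds ℓ)) → (∃ c : ℝ, 0 < c ∧ ∀ (D : Literature.Probability.RandomPlanarGeometry.JordanDomain),
    (∃ S : Finset (ℂ × ℂ), (∀ q ∈ S, q.1.re = q.2.re ∨ q.1.im = q.2.im) ∧ frontier D.carrier ⊆ ⋃ q ∈ S, segment
    ℝ q.1 q.2) → ∀ (x y : ℂ), x ∈ frontier D.carrier → y ∈ frontier D.carrier → x ≠ y → (∃ r : ℝ, 0 < r ∧ ((∀ z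
    ∈ frontier D.carrier, dist z (x) < r → z.im = (x).im) ∨ (∀ z ∈ frontier D.carrier, dist z (x) < r → z.re =
    (x).re))) → (∃ r : ℝ, 0 < r ∧ ((∀ z ∈ frontier D.carrier, dist z (y) < r → z.im = (y).im) ∨ (∀ z ∈ frontier
    D.carrier, dist z (y) < r → z.re = (y).re))) → ∀ (w : ℂ → ℂ) (U : Set ℂ), IsOpen U → D.carrier ⊆ U → x ∈ U →
    y ∈ U → DifferentiableOn ℂ w U → Set.BijOn w D.carrier {z : ℂ | 0 < z.im} → ∀ (δ : ℕ → ℝ), (∀ n, 0 < δ n) →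
    Filter.Tendsto δ Filter.atTop (nhds 0) → ∀ (V : ℕ → Finset (ℤ × ℤ)), (∀ n, ∀ v : ℤ × ℤ, v ∈ V n ↔ (((v).1 :
    ℂ) * ((δ n : ℝ) : ℂ) + ((v).2 : ℂ) * ((δ n : ℝ) : ℂ) * Complex.I) ∈ closure D.carrier) → ∀ (a b : ℕ → ℤ ×
    ℤ), (∀ n, a n ∈ V n ∧ ((Literature.Probability.LatticeModels.CollarLegModel.neighbours (a n)).filter (fun u
    ↦ u ∉ V n)).card = 1) → (∀ n, b n ∈ V n ∧ ((Literature.Probability.LatticeModels.CollarLegModel.neighbours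
    (b n)).filter (fun u ↦ u ∉ V n)).card = 1) → Filter.Tendsto (fun n ↦ (((a n).1 : ℂ) * ((δ n : ℝ) : ℂ) + ((a
    n).2 : ℂ) * ((δ n : ℝ) : ℂ) * Complex.I)) Filter.atTop (nhds x) → Filter.Tendsto (fun n ↦ (((b n).1 : ℂ) *
    ((δ n : ℝ) : ℂ) + ((b n).2 : ℂ) * ((δ n : ℝ) : ℂ) * Complex.I)) Filter.atTop (nhds y) → Filter.Tendsto (fun
    n ↦ (Literature.Probability.LatticeModels.dirichletGreen ((V n).image (fun v : ℤ × ℤ ↦ (![v.1, v.2] : Fin 2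
    → ℤ))) (![(a n).1, (a n).2] : Fin 2 → ℤ) (![(b n).1, (b n).2] : Fin 2 → ℤ)) / (δ n) ^ 2) Filter.atTop (nhds
    (c * (‖deriv w x‖ * ‖deriv w y‖ / ‖w x - w y‖ ^ 2)))) →
    Summit.CriticalPhenomena.CardyFormulaZ2.Theses.CardyBoundaryCoulombGas.BoundaryDefectGaussianR := by
  sorry

/-! ### The composition: the crux BY NAME -/

/-- **The skeleton closes.** Stubs 1–2 give rigidity (Stub 3), Stub 4 the reference limit, Stub 5
the kernel asymptotics, and Stub 6 transfers them to the crux — concluded BY NAME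
(`Summit.CriticalPhenomena.CardyFormulaZ2.Theses.CardyBoundaryCoulombGas.BoundaryDefectGaussianR`,
the signature set 2026-08-16 over the landed `CollarLegModel`). No `sorry` outside the six stubs. [folklore] -/
theorem BoundaryDefectGaussianR_of :
    Summit.CriticalPhenomena.CardyFormulaZ2.Theses.CardyBoundaryCoulombGas.BoundaryDefectGaussianR :=
  stub_transfer (stub_rigidity_of_local_laws stub_pointTransport stub_clusterLocality)
    stub_referenceLimit stub_greenKernelAsymptotics

end Summit.CriticalPhenomena.CardyFormulaZ2.Cruxes.BoundaryDefectGaussianR.RainbowMonomialsInExcursionKernels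

end
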